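import Summits.Parity.GeneralizedHardyLittlewood.Theorems.BeyondDiagonalBeatsQuarter.OffDiagBlockSwitch
import Summits.Parity.GeneralizedHardyLittlewood.Theorems.BeyondDiagonalBeatsQuarter.OffDiagDualStrataCount
import HarnessLib

/-!
# Route `PrimeLevelFamEdge`, crux K_B (stmt-Parity-20343), line `diagonal_kernel_split` rev 4, plan Ω (L6′ strata) —
# **the dual series of a box in switched `(h₁, s)`-form on EVERY stratum (no unit hypothesis on `a` or `b`): the
# multiplicity `N_C(a,b;h₁,h₂)` rides as a weight, supported on the lattice `gcd(a,C)·ℤ ∖ {0}` of dual moduli and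
# bounded by `gcd(a,C)`; reduced variables `h₁ = g·h₁′`, `a = g·a′`, `C = g·C′`**

`OffDiagDualSwitchForm` / `OffDiagBlockSwitch.tsum_trunc_dual_eq_sum_switch(_fourier2)` (S3) need `a = l/d₁` to be a unit
mod `C = q(r+1)` (`N = 𝟙[h₁ unit ∧ h₁h₂ ≡ ab]`), `OffDiagDualSwitchFormRight` (S5) needs `b = m/d₂` to be a unit; on the
DOUBLY NON-UNIT stratum (`(a, r+1) > 1` and `(b, r+1) > 1` — the `coreX` term of the core split) neither applies. Here:
`N_C(a,b;h₁,·)` lives on the hyperbola `h₁h₂ ≡ ab (mod C)` (`dualCount_eq_zero_of_ne`) and the zero dual modulus is absent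
once `a ≢ 0 (mod C)` (`dualCount_zero_left`; at prime level every layer), so the divisor switch `h₂ ↔ s`, `h₁h₂ = ab + Cs`
(`OffDiagDivisorSwitchSeries.tsum_hyperbola_eq_tsum_switch`) applies fiber by fiber on every stratum with the multiplicity
`N_C(a,b;h₁,(ab+Cs)/h₁) ∈ [0, gcd(a,C)]` (E10 `dualCount_natCast_le_gcd`) kept as a weight:

* §1 `mul_dualCount_eq_ite_hyperbola`; `dualCount_intCast_eq_zero_of_not_dvd` (`N = 0` unless `gcd(a,C) ∣ h₁`, integer form
  of E10); `dualCount_intCast_zero_left`; `tsum_switch_count_eq_zero_of_not_dvd` (off the lattice the switched series is `0`);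
* §2 **`tsum_fiber_dual_eq_switch_count`** — `C ≥ 1`, `a ≢ 0`, any `b`, weight `F`, EVERY `h₁`:
  `Σ'_{h₂} F(h₁,h₂)·N_C(a,b;h₁,h₂) = Σ'_{s} 𝟙[h₁ ∣ ab + Cs]·F(h₁,(ab+Cs)/h₁)·N_C(a,b;h₁,(ab+Cs)/h₁)`;
  `summable_switch_count_of_summable_fiber`; `dualCount_switch_eq_ite_of_isUnit` (coprime stratum: the weight IS
  `𝟙[h₁ unit]`, recovering S3);
* §3 **`tsum_dual_eq_tsum_switch_count`** (the `ℤ²`-series);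
* §4 **`tsum_trunc_dual_eq_sum_switch_count`**, `…_lattice`, **`…_fourier2`**, `summable_switch_count_fourier2` — the
  `|h₁| ≤ H`-truncated dual series of a box weight (the summand of `offDiagCore`) is a FINITE sum over `h₁ ∈ [−H,H]`, only
  multiples of `gcd(a,C)` contributing, of switched `s`-series with second frequency `s/h₁ + ab/(h₁C)`: the input shape of
  `OffDiagBlockSwitch.sum_levels_sum_tsum_switch_eq` with `U q h₁ := gcd(a, q(r+1)) ∣ h₁` — `coreX` becomes a switched object;
* §5 with `g = gcd(a,C)`, `h₁ = g·h₁′`, `a′ = a/g`, `C′ = C/g`: `dvd_switch_iff_reduced` (`h₁ ∣ ab+Cs ⟺ h₁′ ∣ a′b+C′s`),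
  `switch_quotient_reduced` (`(ab+Cs)/h₁ = (a′b+C′s)/h₁′`), `switch_frequency_reduced_left` (`h₁/C = h₁′/C′`),
  **`tsum_dual_eq_tsum_switch_reduced`** (the `ℤ²`-series re-indexed over the reduced dual modulus `h₁′ ∈ ℤ`).

NOT here: the resolution of the weight into residue classes of the level `q` (for `C = q(r+1)`, `q ∤ r+1`:
`N = 𝟙[q ∤ h₁]·N_{r+1}(a,b;h₁,h₂)`, `h₂ mod (r+1)` depending on the AP parameter of `q` mod `g` — a `levelAPSum` to modulus
`≤ g·|h₁′|`, BLUEPRINT v3 §3b «same shape, reduced moduli»), and any estimate. Pure algebra over landed identities; theorems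
only; standard axioms. Helper toward `stub_offDiagBelowSlack_io`; closes nothing.
«The programme SEARCHES and TYPES; no claim about Landau–Siegel zeros, Theorems 1–2 of arXiv:2211.02515 or
a repaired Margin232 until a kernel theorem says so.»
-/

noncomputable section

open Finset
open scoped Real FourierTransform

namespace Summit.Parity.GeneralizedHardyLittlewood.Theorems.BeyondDiagonalBeatsQuarter.OffDiag

open Literature.NumberTheory.Sieve.FriedlanderIwaniecPrimes (fourier2)
open OffDiagDual (dualCount_eq_ite_of_isUnit)

variable {C : ℕ} [NeZero C]

/-! ### §1. The multiplicity as a weight: hyperbola support, lattice support, zero modulus -/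

/-- **The weighted multiplicity lives on the hyperbola**: for naturals `a, b`, integers `h₁, h₂` and any weight `F`,
`F(h₁,h₂)·N_C(a,b;h₁,h₂) = 𝟙[h₁h₂ ≡ ab (mod C)]·F(h₁,h₂)·N_C(a,b;h₁,h₂)` (`dualCount_eq_zero_of_ne`). [folklore] -/
theorem mul_dualCount_eq_ite_hyperbola (a b : ℕ) (F : ℤ → ℤ → ℂ) (h₁ h₂ : ℤ) :
    F h₁ h₂ * (dualCount C (a : ZMod C) (b : ZMod C) (h₁ : ZMod C) (h₂ : ZMod C) : ℂ) =
      if (h₁ : ZMod C) * (h₂ : ZMod C) = ((a : ℤ) : ZMod C) * ((b : ℤ) : ZMod C) then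
        F h₁ h₂ * (dualCount C (a : ZMod C) (b : ZMod C) (h₁ : ZMod C) (h₂ : ZMod C) : ℂ) else 0 := by
  by_cases hc : (h₁ : ZMod C) * (h₂ : ZMod C) = (a : ZMod C) * (b : ZMod C)
  · rw [if_pos (by push_cast; exact hc)]
  · rw [if_neg (by push_cast; exact hc), dualCount_eq_zero_of_ne hc, Nat.cast_zero, mul_zero]

/-- **Off the lattice `gcd(a,C)·ℤ` of dual moduli the multiplicity vanishes** (integer form of
`dualCount_natCast_eq_zero_of_not_dvd`): if `gcd(a,C) ∤ h₁` in `ℤ` then `N_C(a,β;h₁,h₂) = 0`. [folklore] -/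
theorem dualCount_intCast_eq_zero_of_not_dvd {a : ℕ} {h₁ : ℤ} (hnd : ¬ ((Nat.gcd a C : ℕ) : ℤ) ∣ h₁)
    (β h₂ : ZMod C) : dualCount C (a : ZMod C) β (h₁ : ZMod C) h₂ = 0 := by
  rw [dualCount, Finset.card_eq_zero]
  exact Finset.filter_false_of_mem fun u _ hu ↦ hnd (gcd_dvd_int_of_mul_add_eq_zero hu.1)

/-- **The zero dual modulus is absent** as soon as `a ≢ 0 (mod C)`: `N_C(a,β;0,h₂) = 0` (integer-cast form of
`dualCount_zero_left`). [folklore] -/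
theorem dualCount_intCast_zero_left {a : ℕ} (ha : (a : ZMod C) ≠ 0) (β h₂ : ZMod C) :
    dualCount C (a : ZMod C) β ((0 : ℤ) : ZMod C) h₂ = 0 := by
  rw [Int.cast_zero]
  exact dualCount_zero_left ha β h₂

/-- **Off the lattice the switched series vanishes**: if `gcd(a,C) ∤ h₁` then for every weight `F`
`Σ'_{s} 𝟙[h₁ ∣ ab + Cs]·F(h₁,(ab+Cs)/h₁)·N_C(a,b;h₁,(ab+Cs)/h₁) = 0` (every multiplicity is `0`). [folklore] -/
theorem tsum_switch_count_eq_zero_of_not_dvd {a : ℕ} (b : ℕ) (F : ℤ → ℤ → ℂ) {h₁ : ℤ}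
    (hnd : ¬ ((Nat.gcd a C : ℕ) : ℤ) ∣ h₁) :
    ∑' s : ℤ, (if h₁ ∣ (a : ℤ) * b + (C : ℤ) * s then
        F h₁ (((a : ℤ) * b + (C : ℤ) * s) / h₁) *
          (dualCount C (a : ZMod C) (b : ZMod C) (h₁ : ZMod C)
            ((((a : ℤ) * b + (C : ℤ) * s) / h₁ : ℤ) : ZMod C) : ℂ) else 0) = 0 := by
  have hz : ∀ s : ℤ, (if h₁ ∣ (a : ℤ) * b + (C : ℤ) * s then
      F h₁ (((a : ℤ) * b + (C : ℤ) * s) / h₁) *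
        (dualCount C (a : ZMod C) (b : ZMod C) (h₁ : ZMod C)
          ((((a : ℤ) * b + (C : ℤ) * s) / h₁ : ℤ) : ZMod C) : ℂ) else 0) = 0 := by
    intro s
    rw [dualCount_intCast_eq_zero_of_not_dvd hnd, Nat.cast_zero, mul_zero, ite_self]
  simp_rw [hz]
  exact tsum_zero

/-! ### §2. The fiber identity on every stratum -/

/-- **The `h₂`-fiber of the dual series in switched form, every stratum.** For `C ≥ 1`, a natural `a ≢ 0 (mod C)`,
any natural `b`, any weight `F : ℤ → ℤ → ℂ` and EVERY `h₁ ∈ ℤ` (no unit hypothesis on `a`, `b` or `h₁`):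
`Σ'_{h₂} F(h₁,h₂)·N_C(a,b;h₁,h₂) = Σ'_{s∈ℤ} 𝟙[h₁ ∣ ab + Cs]·F(h₁,(ab + Cs)/h₁)·N_C(a,b;h₁,(ab + Cs)/h₁)`
(for `h₁ = 0` both sides vanish; otherwise the support re-indexing `h₂ = (ab + Cs)/h₁` on the hyperbola).
[cite: KowalskiMichelVanderKam2000, Lemma 3.3 p. 9 — derivation] -/
theorem tsum_fiber_dual_eq_switch_count (hC : 1 ≤ C) {a : ℕ} (ha : (a : ZMod C) ≠ 0) (b : ℕ)
    (F : ℤ → ℤ → ℂ) (h₁ : ℤ) :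
    ∑' h₂ : ℤ, F h₁ h₂ * (dualCount C (a : ZMod C) (b : ZMod C) (h₁ : ZMod C) (h₂ : ZMod C) : ℂ) =
      ∑' s : ℤ, (if h₁ ∣ (a : ℤ) * b + (C : ℤ) * s then
        F h₁ (((a : ℤ) * b + (C : ℤ) * s) / h₁) *
          (dualCount C (a : ZMod C) (b : ZMod C) (h₁ : ZMod C)
            ((((a : ℤ) * b + (C : ℤ) * s) / h₁ : ℤ) : ZMod C) : ℂ) else 0) := by
  classical
  by_cases hh₁ : h₁ = 0
  · subst hh₁
    have hz : ∀ h₂ : ZMod C, dualCount C (a : ZMod C) (b : ZMod C) ((0 : ℤ) : ZMod C) h₂ = 0 :=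
      fun h₂ ↦ dualCount_intCast_zero_left ha _ h₂
    simp only [hz, Nat.cast_zero, mul_zero, ite_self, tsum_zero]
  · rw [tsum_congr (fun h₂ ↦ mul_dualCount_eq_ite_hyperbola (C := C) a b F h₁ h₂)]
    exact tsum_hyperbola_eq_tsum_switch (M := ℂ) hC hh₁ (fun h₂ ↦ F h₁ h₂ *
      (dualCount C (a : ZMod C) (b : ZMod C) (h₁ : ZMod C) (h₂ : ZMod C) : ℂ))

/-- **The switched `s`-family is summable whenever the `h₂`-fiber of the weighted dual family is** (every stratum).
[folklore] -/
theorem summable_switch_count_of_summable_fiber (hC : 1 ≤ C) {a : ℕ} (ha : (a : ZMod C) ≠ 0) (b : ℕ)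
    (F : ℤ → ℤ → ℂ) (h₁ : ℤ)
    (hf : Summable fun h₂ : ℤ ↦
      F h₁ h₂ * (dualCount C (a : ZMod C) (b : ZMod C) (h₁ : ZMod C) (h₂ : ZMod C) : ℂ)) :
    Summable fun s : ℤ ↦ (if h₁ ∣ (a : ℤ) * b + (C : ℤ) * s then
        F h₁ (((a : ℤ) * b + (C : ℤ) * s) / h₁) *
          (dualCount C (a : ZMod C) (b : ZMod C) (h₁ : ZMod C)
            ((((a : ℤ) * b + (C : ℤ) * s) / h₁ : ℤ) : ZMod C) : ℂ) else 0) := by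
  classical
  by_cases hh₁ : h₁ = 0
  · subst hh₁
    have hz : ∀ h₂ : ZMod C, dualCount C (a : ZMod C) (b : ZMod C) ((0 : ℤ) : ZMod C) h₂ = 0 :=
      fun h₂ ↦ dualCount_intCast_zero_left ha _ h₂
    simp only [hz, Nat.cast_zero, mul_zero, ite_self]
    exact summable_zero
  · have hfib : (fun h₂ : ℤ ↦
        F h₁ h₂ * (dualCount C (a : ZMod C) (b : ZMod C) (h₁ : ZMod C) (h₂ : ZMod C) : ℂ)) =
        fun h₂ : ℤ ↦ if (h₁ : ZMod C) * (h₂ : ZMod C) = ((a : ℤ) : ZMod C) * ((b : ℤ) : ZMod C) then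
          F h₁ h₂ * (dualCount C (a : ZMod C) (b : ZMod C) (h₁ : ZMod C) (h₂ : ZMod C) : ℂ) else 0 :=
      funext fun h₂ ↦ mul_dualCount_eq_ite_hyperbola a b F h₁ h₂
    rw [hfib] at hf
    exact (summable_hyperbola_iff_summable_switch (M := ℂ) hC hh₁ (fun h₂ ↦ F h₁ h₂ *
      (dualCount C (a : ZMod C) (b : ZMod C) (h₁ : ZMod C) (h₂ : ZMod C) : ℂ))).mp hf

/-- **Consistency with the coprime stratum.** If `a` is a unit mod `C` then ON the switched hyperbola the weight is the
unit indicator: for `h₁ ∣ ab + Cs`, `N_C(a,b;h₁,(ab+Cs)/h₁) = 𝟙[h₁ unit mod C]` — so `tsum_fiber_dual_eq_switch_count`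
specialises to `OffDiagBlockSwitch.tsum_fiber_dual_eq_switch`. [folklore] -/
theorem dualCount_switch_eq_ite_of_isUnit (hC : 2 ≤ C) {a : ℕ} (ha : IsUnit ((a : ℕ) : ZMod C)) (b : ℕ)
    {h₁ s : ℤ} [Decidable (IsUnit ((h₁ : ℤ) : ZMod C))] (hd : h₁ ∣ (a : ℤ) * b + (C : ℤ) * s) :
    dualCount C (a : ZMod C) (b : ZMod C) (h₁ : ZMod C) ((((a : ℤ) * b + (C : ℤ) * s) / h₁ : ℤ) : ZMod C) =
      if IsUnit ((h₁ : ℤ) : ZMod C) then 1 else 0 := by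
  rw [dualCount_eq_ite_of_isUnit ha]
  by_cases hu : IsUnit ((h₁ : ℤ) : ZMod C)
  · have hh₁ : h₁ ≠ 0 := intCast_ne_zero_of_isUnit hC hu
    obtain ⟨t, ht⟩ := hd
    have hq : ((a : ℤ) * b + (C : ℤ) * s) / h₁ = t := by rw [ht, Int.mul_ediv_cancel_left _ hh₁]
    -- the hyperbola congruence holds at the switched point
    have hcong : ((h₁ : ℤ) : ZMod C) * ((t : ℤ) : ZMod C) = (a : ZMod C) * (b : ZMod C) := by
      have e : ((h₁ * t : ℤ) : ZMod C) = (((a : ℤ) * b + (C : ℤ) * s : ℤ) : ZMod C) := by rw [ht]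
      push_cast at e
      rw [e, ZMod.natCast_self, zero_mul, add_zero]
    rw [hq, if_pos ⟨hu, hcong⟩, if_pos hu]
  · rw [if_neg (fun h ↦ hu h.1), if_neg hu]

/-! ### §3. The `ℤ²`-series in switched form, every stratum -/

/-- **The dual series in `(h₁, s)`-form with multiplicity weight, every stratum.** For `C ≥ 1`, `a ≢ 0 (mod C)`,
any `b`, any `F : ℤ → ℤ → ℂ` with `h ↦ F(h)·N_C(a,b;h)` summable on `ℤ²`:
`Σ_{h∈ℤ²} F(h₁,h₂)·N_C(a,b;h) = Σ'_{h₁} Σ'_{s} 𝟙[h₁ ∣ ab + Cs]·F(h₁,(ab+Cs)/h₁)·N_C(a,b;h₁,(ab+Cs)/h₁)`.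
[cite: KowalskiMichelVanderKam2000, Lemma 3.3 p. 9 — derivation] -/
theorem tsum_dual_eq_tsum_switch_count (hC : 1 ≤ C) {a : ℕ} (ha : (a : ZMod C) ≠ 0) (b : ℕ)
    (F : ℤ → ℤ → ℂ)
    (hS : Summable fun h : ℤ × ℤ ↦
      F h.1 h.2 * (dualCount C (a : ZMod C) (b : ZMod C) (h.1 : ZMod C) (h.2 : ZMod C) : ℂ)) :
    ∑' h : ℤ × ℤ, F h.1 h.2 * (dualCount C (a : ZMod C) (b : ZMod C) (h.1 : ZMod C) (h.2 : ZMod C) : ℂ) =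
      ∑' h₁ : ℤ, ∑' s : ℤ, (if h₁ ∣ (a : ℤ) * b + (C : ℤ) * s then
        F h₁ (((a : ℤ) * b + (C : ℤ) * s) / h₁) *
          (dualCount C (a : ZMod C) (b : ZMod C) (h₁ : ZMod C)
            ((((a : ℤ) * b + (C : ℤ) * s) / h₁ : ℤ) : ZMod C) : ℂ) else 0) := by
  rw [hS.tsum_prod]
  exact tsum_congr fun h₁ ↦ tsum_fiber_dual_eq_switch_count hC ha b F h₁

/-! ### §4. The truncated dual series of `offDiagCore`, switched on every stratum -/

/-- **Truncated dual series, general weight, every stratum.** For `C ≥ 1`, `a ≢ 0 (mod C)`, any `b`, `H : ℕ` and a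
weight `W` with `h ↦ W(h)·N_C(a,b;h)` summable on `ℤ²`:
`Σ_{h∈ℤ²} 𝟙[|h₁| ≤ H]·W(h₁,h₂)·N = Σ_{h₁∈[−H,H]} Σ'_{s} 𝟙[h₁ ∣ ab + Cs]·W(h₁,(ab+Cs)/h₁)·N_C(a,b;h₁,(ab+Cs)/h₁)`
— a FINITE sum of switched `s`-series. [cite: KowalskiMichelVanderKam2000, Lemma 3.3 p. 9 — derivation] -/
theorem tsum_trunc_dual_eq_sum_switch_count (hC : 1 ≤ C) {a : ℕ} (ha : (a : ZMod C) ≠ 0) (b : ℕ)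
    (W : ℤ → ℤ → ℂ) (H : ℕ)
    (hS : Summable fun h : ℤ × ℤ ↦
      W h.1 h.2 * (dualCount C (a : ZMod C) (b : ZMod C) (h.1 : ZMod C) (h.2 : ZMod C) : ℂ)) :
    ∑' h : ℤ × ℤ, (if |h.1| ≤ (H : ℤ) then
        W h.1 h.2 * (dualCount C (a : ZMod C) (b : ZMod C) (h.1 : ZMod C) (h.2 : ZMod C) : ℂ) else 0) =
      ∑ h₁ ∈ Icc (-(H : ℤ)) H, ∑' s : ℤ, (if h₁ ∣ (a : ℤ) * b + (C : ℤ) * s then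
        W h₁ (((a : ℤ) * b + (C : ℤ) * s) / h₁) *
          (dualCount C (a : ZMod C) (b : ZMod C) (h₁ : ZMod C)
            ((((a : ℤ) * b + (C : ℤ) * s) / h₁ : ℤ) : ZMod C) : ℂ) else 0) := by
  classical
  -- the truncated weight
  set F : ℤ → ℤ → ℂ := fun h₁ h₂ ↦ if |h₁| ≤ (H : ℤ) then W h₁ h₂ else 0 with hF
  have hsummand : ∀ h : ℤ × ℤ, (if |h.1| ≤ (H : ℤ) then
      W h.1 h.2 * (dualCount C (a : ZMod C) (b : ZMod C) (h.1 : ZMod C) (h.2 : ZMod C) : ℂ) else 0) =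
      F h.1 h.2 * (dualCount C (a : ZMod C) (b : ZMod C) (h.1 : ZMod C) (h.2 : ZMod C) : ℂ) := by
    intro h
    simp only [hF]
    split_ifs <;> simp
  have hSF : Summable fun h : ℤ × ℤ ↦
      F h.1 h.2 * (dualCount C (a : ZMod C) (b : ZMod C) (h.1 : ZMod C) (h.2 : ZMod C) : ℂ) := by
    refine (hS.indicator {h : ℤ × ℤ | |h.1| ≤ (H : ℤ)}).congr fun h ↦ ?_
    simp only [Set.indicator_apply, Set.mem_setOf_eq, hF]
    split_ifs <;> simp
  simp_rw [hsummand]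
  rw [tsum_dual_eq_tsum_switch_count hC ha b F hSF]
  -- the outer family vanishes off `[−H, H]`
  rw [tsum_eq_sum (s := Icc (-(H : ℤ)) H)]
  · refine Finset.sum_congr rfl fun h₁ hh₁ ↦ ?_
    rw [Finset.mem_Icc] at hh₁
    have habs : |h₁| ≤ (H : ℤ) := abs_le.mpr hh₁
    simp only [hF, if_pos habs]
  · intro h₁ hh₁
    rw [Finset.mem_Icc, ← abs_le] at hh₁
    simp only [hF, if_neg hh₁, zero_mul, ite_self]
    exact tsum_zero

/-- **… with the finite outer sum displayed on the lattice `gcd(a,C) ∣ h₁`** — the input shape of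
`OffDiagBlockSwitch.sum_levels_sum_tsum_switch_eq` with unit predicate `U q h₁ := gcd(a, C_q) ∣ h₁` and weight
`g q h₁ s := W·N`. [folklore] -/
theorem tsum_trunc_dual_eq_sum_switch_count_lattice (hC : 1 ≤ C) {a : ℕ} (ha : (a : ZMod C) ≠ 0) (b : ℕ)
    (W : ℤ → ℤ → ℂ) (H : ℕ)
    (hS : Summable fun h : ℤ × ℤ ↦
      W h.1 h.2 * (dualCount C (a : ZMod C) (b : ZMod C) (h.1 : ZMod C) (h.2 : ZMod C) : ℂ)) :
    ∑' h : ℤ × ℤ, (if |h.1| ≤ (H : ℤ) then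
        W h.1 h.2 * (dualCount C (a : ZMod C) (b : ZMod C) (h.1 : ZMod C) (h.2 : ZMod C) : ℂ) else 0) =
      ∑ h₁ ∈ Icc (-(H : ℤ)) H, (if ((Nat.gcd a C : ℕ) : ℤ) ∣ h₁ then
        ∑' s : ℤ, (if h₁ ∣ (a : ℤ) * b + (C : ℤ) * s then
          W h₁ (((a : ℤ) * b + (C : ℤ) * s) / h₁) *
            (dualCount C (a : ZMod C) (b : ZMod C) (h₁ : ZMod C)
              ((((a : ℤ) * b + (C : ℤ) * s) / h₁ : ℤ) : ZMod C) : ℂ) else 0) else 0) := by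
  rw [tsum_trunc_dual_eq_sum_switch_count hC ha b W H hS]
  refine Finset.sum_congr rfl fun h₁ _ ↦ ?_
  by_cases hg : ((Nat.gcd a C : ℕ) : ℤ) ∣ h₁
  · rw [if_pos hg]
  · rw [if_neg hg]
    exact tsum_switch_count_eq_zero_of_not_dvd b W hg

/-- **Truncated dual series of a box weight (the summand of `offDiagCore`), switched on every stratum.** For `C ≥ 1`,
`a ≢ 0 (mod C)`, any `b`, any `Φ : ℝ → ℝ → ℂ` whose weighted dual family is summable (box weights:
`OffDiag.summable_dual`) and `H : ℕ`:
`Σ_{h∈ℤ²} 𝟙[|h₁| ≤ H]·Φ̂(h₁/C,h₂/C)·N_C(a,b;h)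
   = Σ_{h₁∈[−H,H]} Σ'_{s∈ℤ} 𝟙[h₁ ∣ ab + Cs]·Φ̂(h₁/C, s/h₁ + ab/(h₁C))·N_C(a,b;h₁,(ab+Cs)/h₁)`
(the second frequency in the shifted-lattice form consumed by `OffDiagDualCompletion*` / `OffDiagPrincipalBlock`).
[cite: KowalskiMichelVanderKam2000, Lemma 3.3 p. 9 — derivation] -/
theorem tsum_trunc_dual_eq_sum_switch_count_fourier2 (hC : 1 ≤ C) {a : ℕ} (ha : (a : ZMod C) ≠ 0) (b : ℕ)
    (Φ : ℝ → ℝ → ℂ) (H : ℕ)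
    (hS : Summable fun h : ℤ × ℤ ↦ fourier2 Φ (h.1 / C) (h.2 / C) *
      (dualCount C (a : ZMod C) (b : ZMod C) (h.1 : ZMod C) (h.2 : ZMod C) : ℂ)) :
    ∑' h : ℤ × ℤ, (if |h.1| ≤ (H : ℤ) then fourier2 Φ (h.1 / C) (h.2 / C) *
        (dualCount C (a : ZMod C) (b : ZMod C) (h.1 : ZMod C) (h.2 : ZMod C) : ℂ) else 0) =
      ∑ h₁ ∈ Icc (-(H : ℤ)) H, ∑' s : ℤ, (if h₁ ∣ (a : ℤ) * b + (C : ℤ) * s then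
        fourier2 Φ (h₁ / C) ((s : ℝ) / h₁ + ((a : ℤ) * b : ℝ) / ((h₁ : ℝ) * C)) *
          (dualCount C (a : ZMod C) (b : ZMod C) (h₁ : ZMod C)
            ((((a : ℤ) * b + (C : ℤ) * s) / h₁ : ℤ) : ZMod C) : ℂ) else 0) := by
  rw [tsum_trunc_dual_eq_sum_switch_count hC ha b (fun h₁ h₂ ↦ fourier2 Φ (h₁ / C) (h₂ / C)) H hS]
  refine Finset.sum_congr rfl fun h₁ _ ↦ tsum_congr fun s ↦ ?_
  by_cases hd : h₁ ∣ (a : ℤ) * b + (C : ℤ) * s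
  · rw [if_pos hd, if_pos hd]
    by_cases hh₁ : h₁ = 0
    · -- zero dual modulus: the weight vanishes on both sides
      subst hh₁
      rw [dualCount_intCast_zero_left ha, Nat.cast_zero, mul_zero, mul_zero]
    · rw [switch_frequency_eq hh₁ hd]
      push_cast
      ring_nf
  · rw [if_neg hd, if_neg hd]

/-- **The switched `s`-series of a box weight with multiplicity is summable** for every dual modulus `h₁` (from the
`h₂`-fiber of the weighted dual family). [folklore] -/
theorem summable_switch_count_fourier2 (hC : 1 ≤ C) {a : ℕ} (ha : (a : ZMod C) ≠ 0) (b : ℕ)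
    (Φ : ℝ → ℝ → ℂ) (h₁ : ℤ)
    (hS : Summable fun h : ℤ × ℤ ↦ fourier2 Φ (h.1 / C) (h.2 / C) *
      (dualCount C (a : ZMod C) (b : ZMod C) (h.1 : ZMod C) (h.2 : ZMod C) : ℂ)) :
    Summable fun s : ℤ ↦ (if h₁ ∣ (a : ℤ) * b + (C : ℤ) * s then
      fourier2 Φ (h₁ / C) ((s : ℝ) / h₁ + ((a : ℤ) * b : ℝ) / ((h₁ : ℝ) * C)) *
        (dualCount C (a : ZMod C) (b : ZMod C) (h₁ : ZMod C)
          ((((a : ℤ) * b + (C : ℤ) * s) / h₁ : ℤ) : ZMod C) : ℂ) else 0) := by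
  have h := summable_switch_count_of_summable_fiber hC ha b (fun h₁ h₂ ↦ fourier2 Φ (h₁ / C) (h₂ / C)) h₁
    (hS.prod_factor h₁)
  refine h.congr fun s ↦ ?_
  by_cases hd : h₁ ∣ (a : ℤ) * b + (C : ℤ) * s
  · simp only [if_pos hd]
    by_cases hh₁ : h₁ = 0
    · subst hh₁
      rw [dualCount_intCast_zero_left ha, Nat.cast_zero, mul_zero, mul_zero]
    · rw [switch_frequency_eq hh₁ hd]
      push_cast
      ring_nf
  · simp only [if_neg hd]

/-! ### §5. Reduced variables: `h₁ = g·h₁′`, `a = g·a′`, `C = g·C′`, `g = gcd(a, C)` -/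

section Reduced

/-- `g = gcd(a,C)` is positive (as `C ≠ 0`). [folklore] -/
theorem gcd_pos_of_neZero (a : ℕ) : 0 < Nat.gcd a C :=
  Nat.gcd_pos_of_pos_right a (Nat.pos_of_ne_zero (NeZero.ne C))

/-- **Reduced divisibility.** With `g = gcd(a,C)` and `h₁ = g·h₁′`:
`h₁ ∣ ab + Cs ⟺ h₁′ ∣ (a/g)·b + (C/g)·s`. [folklore] -/
theorem dvd_switch_iff_reduced {a : ℕ} (b : ℕ) (h₁' s : ℤ) :
    ((Nat.gcd a C : ℕ) : ℤ) * h₁' ∣ (a : ℤ) * b + (C : ℤ) * s ↔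
      h₁' ∣ ((a / Nat.gcd a C : ℕ) : ℤ) * b + ((C / Nat.gcd a C : ℕ) : ℤ) * s := by
  set g := Nat.gcd a C with hg
  have hg0 : (g : ℤ) ≠ 0 := by exact_mod_cast (gcd_pos_of_neZero (C := C) a).ne'
  have ha : (a : ℤ) = (g : ℤ) * ((a / g : ℕ) : ℤ) := by
    exact_mod_cast (Nat.mul_div_cancel' (Nat.gcd_dvd_left a C)).symm
  have hCg : (C : ℤ) = (g : ℤ) * ((C / g : ℕ) : ℤ) := by
    exact_mod_cast (Nat.mul_div_cancel' (Nat.gcd_dvd_right a C)).symm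
  rw [ha, hCg, show (g : ℤ) * ((a / g : ℕ) : ℤ) * b + (g : ℤ) * ((C / g : ℕ) : ℤ) * s =
    (g : ℤ) * (((a / g : ℕ) : ℤ) * b + ((C / g : ℕ) : ℤ) * s) by ring]
  exact mul_dvd_mul_iff_left hg0

/-- **Reduced quotient.** With `g = gcd(a,C)` and `h₁ = g·h₁′`: `(ab + Cs)/h₁ = ((a/g)·b + (C/g)·s)/h₁′` (integer
division; both exact under the divisibility). [folklore] -/
theorem switch_quotient_reduced {a : ℕ} (b : ℕ) (h₁' s : ℤ) :
    ((a : ℤ) * b + (C : ℤ) * s) / (((Nat.gcd a C : ℕ) : ℤ) * h₁') =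
      (((a / Nat.gcd a C : ℕ) : ℤ) * b + ((C / Nat.gcd a C : ℕ) : ℤ) * s) / h₁' := by
  set g := Nat.gcd a C with hg
  have hg0 : 0 < (g : ℤ) := by exact_mod_cast gcd_pos_of_neZero (C := C) a
  have ha : (a : ℤ) = (g : ℤ) * ((a / g : ℕ) : ℤ) := by
    exact_mod_cast (Nat.mul_div_cancel' (Nat.gcd_dvd_left a C)).symm
  have hCg : (C : ℤ) = (g : ℤ) * ((C / g : ℕ) : ℤ) := by
    exact_mod_cast (Nat.mul_div_cancel' (Nat.gcd_dvd_right a C)).symm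
  rw [ha, hCg, show (g : ℤ) * ((a / g : ℕ) : ℤ) * b + (g : ℤ) * ((C / g : ℕ) : ℤ) * s =
    (g : ℤ) * (((a / g : ℕ) : ℤ) * b + ((C / g : ℕ) : ℤ) * s) by ring]
  exact Int.mul_ediv_mul_of_pos _ _ hg0

/-- **Reduced first frequency**: `h₁/C = h₁′/C′` for `h₁ = g·h₁′`, `C = g·C′`. [folklore] -/
theorem switch_frequency_reduced_left {a : ℕ} (h₁' : ℤ) :
    ((((Nat.gcd a C : ℕ) : ℤ) * h₁' : ℤ) : ℝ) / (C : ℝ) = (h₁' : ℝ) / ((C / Nat.gcd a C : ℕ) : ℝ) := by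
  set g := Nat.gcd a C with hg
  have hg0 : (g : ℝ) ≠ 0 := by exact_mod_cast (gcd_pos_of_neZero (C := C) a).ne'
  have hCg : (C : ℝ) = (g : ℝ) * ((C / g : ℕ) : ℝ) := by
    exact_mod_cast (Nat.mul_div_cancel' (Nat.gcd_dvd_right a C)).symm
  rw [hCg]
  simp only [Int.cast_mul, Int.cast_natCast]
  exact mul_div_mul_left _ _ hg0

/-- **The dual series re-indexed over the reduced dual modulus.** For `C ≥ 1`, `a ≢ 0 (mod C)`, any `b`, any weight
`F` with `h ↦ F(h)·N_C(a,b;h)` summable, and `g = gcd(a,C)`, `a′ = a/g`, `C′ = C/g`: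
`Σ_{h∈ℤ²} F(h)·N_C(a,b;h) = Σ'_{h₁′∈ℤ} Σ'_{s∈ℤ} 𝟙[h₁′ ∣ a′b + C′s]·F(g·h₁′,(a′b+C′s)/h₁′)·N_C(a,b;g·h₁′,(a′b+C′s)/h₁′)`
(only the multiples `h₁ = g·h₁′` of `g` carry a multiplicity; on them the divisor condition and the switched `h₂` are the
reduced ones). [cite: KowalskiMichelVanderKam2000, Lemma 3.3 p. 9 — derivation] -/
theorem tsum_dual_eq_tsum_switch_reduced (hC : 1 ≤ C) {a : ℕ} (ha : (a : ZMod C) ≠ 0) (b : ℕ) (F : ℤ → ℤ → ℂ)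
    (hS : Summable fun h : ℤ × ℤ ↦
      F h.1 h.2 * (dualCount C (a : ZMod C) (b : ZMod C) (h.1 : ZMod C) (h.2 : ZMod C) : ℂ)) :
    ∑' h : ℤ × ℤ, F h.1 h.2 * (dualCount C (a : ZMod C) (b : ZMod C) (h.1 : ZMod C) (h.2 : ZMod C) : ℂ) =
      ∑' h₁' : ℤ, ∑' s : ℤ,
        (if h₁' ∣ ((a / Nat.gcd a C : ℕ) : ℤ) * b + ((C / Nat.gcd a C : ℕ) : ℤ) * s then
          F (((Nat.gcd a C : ℕ) : ℤ) * h₁')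
              ((((a / Nat.gcd a C : ℕ) : ℤ) * b + ((C / Nat.gcd a C : ℕ) : ℤ) * s) / h₁') *
            (dualCount C (a : ZMod C) (b : ZMod C) ((((Nat.gcd a C : ℕ) : ℤ) * h₁' : ℤ) : ZMod C)
              (((((a / Nat.gcd a C : ℕ) : ℤ) * b + ((C / Nat.gcd a C : ℕ) : ℤ) * s) / h₁' : ℤ) : ZMod C) : ℂ)
        else 0) := by
  classical
  have hg0 : ((Nat.gcd a C : ℕ) : ℤ) ≠ 0 := by exact_mod_cast (gcd_pos_of_neZero (C := C) a).ne'
  -- the switched inner series as a function of the dual modulus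
  set T : ℤ → ℂ := fun h₁ ↦ ∑' s : ℤ, (if h₁ ∣ (a : ℤ) * b + (C : ℤ) * s then
      F h₁ (((a : ℤ) * b + (C : ℤ) * s) / h₁) *
        (dualCount C (a : ZMod C) (b : ZMod C) (h₁ : ZMod C)
          ((((a : ℤ) * b + (C : ℤ) * s) / h₁ : ℤ) : ZMod C) : ℂ) else 0) with hT
  rw [tsum_dual_eq_tsum_switch_count hC ha b F hS]
  change ∑' h₁ : ℤ, T h₁ = _
  -- `T` is supported on the multiples of `g`: re-index by `h₁ = g·h₁′`
  have hsupp : Function.support T ⊆ Set.range (fun h₁' : ℤ ↦ ((Nat.gcd a C : ℕ) : ℤ) * h₁') := by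
    intro h₁ hh₁
    rw [Function.mem_support] at hh₁
    by_contra hrange
    apply hh₁
    have hnd : ¬ ((Nat.gcd a C : ℕ) : ℤ) ∣ h₁ := by
      rintro ⟨t, rfl⟩
      exact hrange ⟨t, rfl⟩
    exact tsum_switch_count_eq_zero_of_not_dvd b F hnd
  have hinj : Function.Injective (fun h₁' : ℤ ↦ ((Nat.gcd a C : ℕ) : ℤ) * h₁') := mul_right_injective₀ hg0
  rw [← hinj.tsum_eq hsupp]
  refine tsum_congr fun h₁' ↦ ?_
  simp only [hT]
  refine tsum_congr fun s ↦ ?_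
  have hiff := dvd_switch_iff_reduced (C := C) (a := a) b h₁' s
  by_cases hd : h₁' ∣ ((a / Nat.gcd a C : ℕ) : ℤ) * b + ((C / Nat.gcd a C : ℕ) : ℤ) * s
  · rw [if_pos (hiff.mpr hd), if_pos hd, switch_quotient_reduced (C := C) (a := a) b h₁' s]
  · rw [if_neg (fun h ↦ hd (hiff.mp h)), if_neg hd]

end Reduced

end Summit.Parity.GeneralizedHardyLittlewood.Theorems.BeyondDiagonalBeatsQuarter.OffDiag
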